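import Literature.Barriers.AtomisticToContinuum.DisorderedHarmonicChainFurstenbergAmplitude
import Literature.Probability.RandomMatrixProducts.AndersonModel1DSmoothing
import HarnessLib

/-!
# Ajanki–Huveneers 2011: the high-frequency term (H) and the root reduction from Fürstenberg positivity ALONE

Companion to `DisorderedHarmonicChainFurstenberg.lean` and `…FurstenbergAmplitude.lean` (the Casher–Lebowitz / Ajanki–Huveneers
cluster of `Literature/Barriers/AtomisticToContinuum/`; root fact `AjankiHuveneers2011_scaling`,
Thm 1.1 of O. Ajanki, F. Huveneers, CMP **301** (2011) 841–883, arXiv:1003.1076).  That file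
proved the high-frequency bound

  (H) `AjankiHuveneers2011_highFrequencyBound`

from TWO vendored facts about the one-dimensional Anderson model (Bucaj–Damanik–Fillman–Gerbuz–
VandenBoom–Wang–Zhang, TAMS **372** (2019), arXiv:1706.06135): Fürstenberg positivity
`BucajEtAl2019_lyapunovPos` (Thm 2.3) and the vectorwise uniform large-deviation theorem
`BucajEtAl2019_vectorLDT` (Prop. 3.6), the latter entering only through the "pointwise core"
`chain_logMoment_lower`: a scale `N` with `𝔼 log ‖Q_N(ω) v‖ ≥ 2` for every unit vector `v`.

Here the large-deviation input is REMOVED.  The single-mass law has a bounded density `τ`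
supported in `[a, b] ⊂ (0, ∞)`, so the law of the potentials `ω² m_k` has density `≤ ‖τ‖_∞/ω²`
and support in `[-bω², bω²]`; for such laws `AndersonModel1DSmoothing.lean` PROVES the pointwise
core from positivity of the Lyapunov exponent alone (two-step direction smoothing plus
`L ≤ n⁻¹𝔼 log‖M_n‖`, `exists_scale_logMoment_ge_two`).  Feeding this core into the `_of_core`
chain of `DisorderedHarmonicChainFurstenberg.lean` gives

* `chain_logMoment_lower_of_pos : BucajEtAl2019_lyapunovPos → (pointwise core at every ω > 0)`;
* `AjankiHuveneers2011_highFrequencyBound_of_lyapunovPos :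
     BucajEtAl2019_lyapunovPos → AjankiHuveneers2011_highFrequencyBound`;
* `OConnor1975_amplitudeBound_of_lyapunovPos : BucajEtAl2019_lyapunovPos → OConnor1975_amplitudeBound`;
* `AjankiHuveneers2011_scaling_of_lyapunovPos :
     BucajEtAl2019_lyapunovPos → AjankiHuveneers2011_lowFrequencyBound →
     AjankiHuveneers2011_criticalBandLowerBound → AjankiHuveneers2011_scaling`.

So the trust base of the vendored barrier fact `AjankiHuveneers2011_scaling` is now exactly:
Fürstenberg positivity for the Anderson model (Bucaj et al. Thm 2.3 = Fürstenberg 1963 for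
`SL(2,ℝ)` Schrödinger cocycles) and the two low-frequency bounds (U), (L) of AH2011 §6; the
steady state, the current formula, the transfer-matrix reduction and (H) are proved.
-/

noncomputable section

open MeasureTheory Filter Set
open scoped Matrix.Norms.L2Operator Matrix ENNReal

namespace Literature.Barriers.AtomisticToContinuum.HeatConduction

open Literature.Probability.RandomMatrixProducts

/-- A mass density satisfying the standing hypothesis is bounded: `0 ≤ τ ≤ T` for some `T ≥ 0`
(continuity on the compact `[a,b]`, zero outside). [folklore] -/
theorem MassDensityHyp.exists_upper_bound {τ : ℝ → ℝ} {a b : ℝ} (hyp : MassDensityHyp τ a b) :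
    ∃ T : ℝ, 0 ≤ T ∧ ∀ s, τ s ≤ T := by
  obtain ⟨C, hC⟩ := isCompact_Icc.exists_bound_of_continuousOn hyp.continuousOn
  refine ⟨max C 0, le_max_right _ _, fun s => ?_⟩
  by_cases hs : s ∈ Set.Icc a b
  · exact ((le_abs_self _).trans ((Real.norm_eq_abs _).symm.le.trans (hC s hs))).trans (le_max_left _ _)
  · rw [hyp.eq_zero s hs]; exact le_max_right _ _

/-- **Density bound for the law of the potentials.** With `ν_ω = (x ↦ ω²x)_* ρ` and `τ ≤ T`:
`ν_ω[p, q] ≤ (T/ω²)(q - p)` for all `p, q`. [folklore] -/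
theorem map_smul_Icc_le {τ : ℝ → ℝ} {ρ : Measure ℝ}
    (hρ : ρ = volume.withDensity fun s => ENNReal.ofReal (τ s)) {T : ℝ} (hT0 : 0 ≤ T) (hT : ∀ s, τ s ≤ T)
    {c : ℝ} (hc : 0 < c) (p q : ℝ) :
    (ρ.map fun x => c * x) (Set.Icc p q) ≤ ENNReal.ofReal (T / c * (q - p)) := by
  rw [Measure.map_apply (by fun_prop) measurableSet_Icc]
  have hpre : (fun x => c * x) ⁻¹' Set.Icc p q = Set.Icc (p / c) (q / c) := by
    ext x
    simp only [Set.mem_preimage, Set.mem_Icc]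
    rw [div_le_iff₀ hc, le_div_iff₀ hc, mul_comm x c]
  rw [hpre, hρ, withDensity_apply _ measurableSet_Icc]
  calc ∫⁻ s in Set.Icc (p / c) (q / c), ENNReal.ofReal (τ s) ∂volume
      ≤ ∫⁻ _s in Set.Icc (p / c) (q / c), ENNReal.ofReal T ∂volume :=
        lintegral_mono fun s => ENNReal.ofReal_le_ofReal (hT s)
    _ = ENNReal.ofReal T * volume (Set.Icc (p / c) (q / c)) := by
        rw [setLIntegral_const]
    _ ≤ ENNReal.ofReal (T / c * (q - p)) := by
        rw [Real.volume_Icc]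
        rcases le_or_gt p q with hpq | hpq
        · rw [← ENNReal.ofReal_mul hT0]
          apply ENNReal.ofReal_le_ofReal
          apply le_of_eq; ring
        · have : q / c - p / c ≤ 0 := by
            rw [sub_nonpos]; exact div_le_div_of_nonneg_right hpq.le hc.le
          rw [ENNReal.ofReal_of_nonpos this, mul_zero]
          exact bot_le

/-- The law of the potentials is carried by `[-bω², bω²]`: `|x| ≤ bω²` a.s. [folklore] -/
theorem ae_map_smul_abs_le {τ : ℝ → ℝ} {a b : ℝ} (hyp : MassDensityHyp τ a b) {ρ : Measure ℝ}
    (hρ : ρ = volume.withDensity fun s => ENNReal.ofReal (τ s)) {c : ℝ} (hc : 0 < c) :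
    ∀ᵐ x ∂(ρ.map fun x => c * x), |x| ≤ b * c := by
  refine (ae_map_iff (by fun_prop : Measurable fun x : ℝ => c * x).aemeasurable
    (measurableSet_le continuous_abs.measurable measurable_const)).mpr ?_
  have hIcc : ∀ᵐ x ∂ρ, x ∈ Set.Icc a b := by
    rw [ae_iff]
    exact measure_compl_Icc_eq_zero hyp.eq_zero hρ
  filter_upwards [hIcc] with x hx
  have ha := hyp.pos
  rw [abs_of_nonneg (by nlinarith [hx.1])]
  nlinarith [hx.2]

/-- **The pointwise core from Fürstenberg positivity alone.** Under `BucajEtAl2019_lyapunovPos`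
(Bucaj et al. Thm 2.3) — and WITHOUT any large-deviation input — for every admissible mass density
and every frequency `ω > 0` there is a scale `N ≥ 1` with `𝔼 log ‖Q_N(ω) v‖ ≥ 2` for every unit
vector `v`: the law of the potentials `ω² m_k` has a bounded density and compact support, so
`exists_scale_logMoment_ge_two` (two-step direction smoothing) applies at energy `E = 2`.
[cite: BucajEtAl2019, Thm 2.3] -/
theorem chain_logMoment_lower_of_pos (hP : BucajEtAl2019_lyapunovPos)
    {τ : ℝ → ℝ} {a b : ℝ} (hyp : MassDensityHyp τ a b) {ρ : Measure ℝ} [IsProbabilityMeasure ρ]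
    (hρ : ρ = volume.withDensity fun s => ENNReal.ofReal (τ s)) {ω : ℝ} (hω0 : 0 < ω) :
    ∃ N : ℕ, 1 ≤ N ∧ ∀ v : EuclideanSpace ℝ (Fin 2), ‖v‖ = 1 →
      2 ≤ ∫ m, Real.log ‖Matrix.toEuclideanLin (andersonTransferProd 2 (padSeq (ω ^ 2 • m)) N) v‖
        ∂(Measure.pi fun _ : Fin N => ρ) := by
  have hb : 0 ≤ b := hyp.pos.le.trans hyp.lt.le
  have hc : 0 < ω ^ 2 := pow_pos hω0 2
  set ν : Measure ℝ := ρ.map fun x => ω ^ 2 * x with hν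
  haveI : IsProbabilityMeasure ν := isProbabilityMeasure_map_smul ρ _
  have hcpt : IsCompact ν.support := isCompact_support_map_smul hyp.eq_zero hρ hc
  have hnt : ν.support.Nontrivial := support_map_smul_nontrivial hρ hc
  have hLpos : 0 < andersonLyapunov ν 2 := hP ν hcpt hnt 2
  obtain ⟨T, hT0, hT⟩ := hyp.exists_upper_bound
  have hK : ∀ p q : ℝ, ν (Set.Icc p q) ≤ ENNReal.ofReal (T / ω ^ 2 * (q - p)) :=
    map_smul_Icc_le hρ hT0 hT hc
  have hR : ∀ᵐ x ∂ν, |x| ≤ b * ω ^ 2 := ae_map_smul_abs_le hyp hρ hc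
  obtain ⟨N, hN1, hcore⟩ :=
    exists_scale_logMoment_ge_two (μ := ν) (by positivity) hK hR (by positivity) 2 hLpos
  refine ⟨N, hN1, fun v hv => ?_⟩
  have h := hcore v hv
  -- transport the integral from the i.i.d. potentials to the i.i.d. masses
  have hmeas : Measurable fun α : Fin N → ℝ =>
      Real.log ‖Matrix.toEuclideanLin (andersonTransferProd 2 (padSeq α) N) v‖ :=
    (measurable_norm_andersonTransferProd_apply 2 N v).log
  rw [hν, ← pi_map_smul ρ (ω ^ 2) N, integral_map (by fun_prop : Measurable fun m : Fin N → ℝ =>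
    (ω ^ 2) • m).aemeasurable hmeas.aestronglyMeasurable] at h
  exact h

end Literature.Barriers.AtomisticToContinuum.HeatConduction

namespace Literature.Barriers.AtomisticToContinuum

open HeatConduction Literature.Probability.RandomMatrixProducts

/-- **(H) from Fürstenberg positivity alone.** Positivity of the Lyapunov exponent of the
one-dimensional Anderson model (Bucaj et al. Thm 2.3, i.e. Fürstenberg's theorem for the
Schrödinger cocycle, applied at energy `E = 2` to the law of the potentials `ω² m_k`) implies the
high-frequency bound `∫_{ω₀}^∞ 𝔼 j_n ≤ C e^{-c√n}` of the Ajanki–Huveneers decomposition (the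
term AH2011 take from O'Connor 1975, Thm 6), with the rate `e^{-cn}`; no large-deviation theorem
is used. [cite: AjankiHuveneers2011, §2 ¶3 and §6.2 (the term `𝒥₃`)] [cite: BucajEtAl2019, Thm 2.3] -/
theorem AjankiHuveneers2011_highFrequencyBound_of_lyapunovPos (hP : BucajEtAl2019_lyapunovPos) :
    AjankiHuveneers2011_highFrequencyBound :=
  AjankiHuveneers2011_highFrequencyBound_of_core fun _τ _a _b hyp _ρ _ hρ _ω hω =>
    chain_logMoment_lower_of_pos hP hyp hρ hω

/-- **O'Connor's amplitude bound (39) from Fürstenberg positivity alone**: the moderate-deviation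
input of O'Connor's proof of his Thm 6, `ℙ(t_n² ≤ e^{γn}) ≤ C e^{-α√n}` uniformly on compact bands
(vendored in `DisorderedHarmonicChainHighFrequency.lean`), follows from `BucajEtAl2019_lyapunovPos`
(rate `e^{-αn}`). [cite: OConnor1975, §3 eq. (39)] [cite: BucajEtAl2019, Thm 2.3] -/
theorem OConnor1975_amplitudeBound_of_lyapunovPos (hP : BucajEtAl2019_lyapunovPos) :
    OConnor1975_amplitudeBound :=
  OConnor1975_amplitudeBound_of_core fun _τ _a _b hyp _ρ _ hρ _ω hω =>
    chain_logMoment_lower_of_pos hP hyp hρ hω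

/-- **The root fact on its reduced trust base.** The vendored barrier fact
`AjankiHuveneers2011_scaling` (Ajanki–Huveneers 2011, Thm 1.1, SDE side) follows from exactly
three named facts: Fürstenberg positivity for the one-dimensional Anderson model
(`BucajEtAl2019_lyapunovPos`) and the two low-frequency bounds of AH2011 §6
(`AjankiHuveneers2011_lowFrequencyBound` (U), `AjankiHuveneers2011_criticalBandLowerBound` (L));
the steady state, the current formula, the transfer-matrix reduction and the high-frequency bound
(H) are proved in this cluster.
[cite: AjankiHuveneers2011, Thm 1.1, §2.1 eqs. (2.5)-(2.7), §6] [cite: BucajEtAl2019, Thm 2.3] -/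
theorem AjankiHuveneers2011_scaling_of_lyapunovPos (hP : BucajEtAl2019_lyapunovPos)
    (hU : AjankiHuveneers2011_lowFrequencyBound) (hL : AjankiHuveneers2011_criticalBandLowerBound) :
    AjankiHuveneers2011_scaling :=
  AjankiHuveneers2011_scaling_of_spectralScaling
    (AjankiHuveneers2011_spectralScaling_of_bounds hU
      (AjankiHuveneers2011_highFrequencyBound_of_lyapunovPos hP) hL)

end Literature.Barriers.AtomisticToContinuum

end
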